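import Summits.AnomalousDissipation.AnomalousDissipation.Theses.RootDecompCycle2B

/-!
# Glue of the split of `RootDecompCycle2B.LoudStretches` (stmt-AnomalousDissipation-26351)

Sorry-free proof of the GLUE item `RootDecompCycle2B.LoudStretchesGlue` (stmt-AnomalousDissipation-27269):
`SubpassiveStretches → NoIntermediateExponent → CeilingAttainment → LoudStretches` — composition: the sub-passive
stretches (growth exponent κ < 1/3) are upgraded by `NoIntermediateExponent` to stretches at every exponent κ > 0, which
`CeilingAttainment` turns into loud capped stretches.  No facts are asserted.
Source: decomp-ad cell, route-AnomalousDissipation-RootDecompCycle2B (writer split of 26351; children-imply-parent by construction);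
landed by the cell's prover seat.
-/

set_option linter.dupNamespace false

namespace Summit.AnomalousDissipation.AnomalousDissipation.Theorems.LoudStretchesGlue

open Summit.AnomalousDissipation.AnomalousDissipation.Theses.RootDecompCycle2B

/-- The GLUE item `RootDecompCycle2B.LoudStretchesGlue` (stmt-AnomalousDissipation-27269) holds: composition. [folklore] -/
theorem loudStretchesGlue_holds : LoudStretchesGlue :=
  fun hS hN hC => hC (hN hS)

end Summit.AnomalousDissipation.AnomalousDissipation.Theorems.LoudStretchesGlue
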